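import Mathlib
import Summits.KontsevichZagierPeriods.KontsevichZagierPeriods.Theses.InverseLandau
import Literature.NumberTheory.Transcendental.KZProductIdeal
import Summits.KontsevichZagierPeriods.KontsevichZagierPeriods.Theorems.InverseLandauTateLiftingPullback
import Summits.KontsevichZagierPeriods.KontsevichZagierPeriods.Theorems.InverseLandauTateLiftingArcsinBandValue
import Summits.KontsevichZagierPeriods.KontsevichZagierPeriods.Theorems.InverseLandauTateLiftingSLTwoZCovolume
import Summits.KontsevichZagierPeriods.KontsevichZagierPeriods.Theorems.ComplexOrientationsTypeOneIdentitiesStubDiscRepValue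
import Summits.KontsevichZagierPeriods.KontsevichZagierPeriods.Theorems.ComplexOrientationsTypeOneIdentitiesStubDiscRepExists

/-!
# `TateLifting` (stmt-KontsevichZagierPeriods-9129), line `Sketch` — stub `stub_minkowskiBinaryAccessible`

MINKOWSKI-REDUCED BINARY FORMS INSIDE THE KONTSEVICH–ZAGIER RULES (item `MinkowskiBinaryAccessible`,
stmt-KontsevichZagierPeriods-4419, of route SiegelTamagawa, verbatim): the volume of the cone
`R = {2|y₂| ≤ y₀ ≤ y₁, 0 < y₀y₁ − y₂² < 1} ⊆ ℝ³` of Minkowski-reduced positive binary quadratic forms of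
discriminant `< 1`, i.e. `[R, 1]`, is `KZ.Equivalent` to the open disc of radius `√(2/9)` with integrand `1`
(both represent `2π/9`). The chain (`tateLifting_minkowskiBinaryAccessible`): rule (2), relabel
`(y₀, y₁, y₂) ↦ (y₀, y₂, y₁)`; rule (1), close the band by the null graph `y₁ = (1 + y₂²)/y₀`; rule (3) along
`y₁` with primitive `y₁` (`tateLifting_bandArea`): `[R, 1] ≡ [τ, (1 + y₂²)/y₀ − y₀]` over
`τ = {y₀ > 0, 2|y₂| ≤ y₀, y₀² < 1 + y₂²}` (`cone_to_base`); rule (2), the shear `(t, y₀) ↦ (y₀, y₀t)` of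
`Ω = {t² ≤ ¼, y₀ > 0, y₀²(1 − t²) < 1}` onto `τ`, `|det| = y₀` (`tateLifting_pullback`): `≡ [Ω, 1 − y₀²(1 − t²)]`
(`base_to_shearSource`); rule (1), `Ω` is co-null in the closed arcsine band `Ḡ = {t² ≤ ¼, 0 ≤ y₀ ≤ 1/√(1 − t²)}`
of `Theorems/InverseLandauTateLiftingSLTwoZCovolume.lean`, and rule (3) along `y₀` with primitive
`y₀ − y₀³(1 − t²)/3` and the semialgebraic edge `1/√(1 − t²)`: `≡ A = [{t² ≤ ¼}, 2/(3√(1 − t²))]`, of value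
`(2/3)(π/3)` (`ArcsinBand.integral_invSqrt`) (`shearSource_to_arc`); finally the open disc is co-null in the band
`B = {9t² < 2, |s| ≤ √(2 − 9t²)/3}` of the conic `9(t² + s²) = 2`, `[B, 1]` has the value `π · 2/9` of the disc
(`TypeOneIdentities.stub_discRepValue`), and `[B, 1] ∼ A` by the landed conic-band kernel
`kzPeriodConjecture_conicBand_genusZero` (Conjecture 1 on the genus-zero sector). No definition is introduced.
References: M. Kontsevich, D. Zagier, *Periods* (2001), §1.2 rules (1)–(3); J. Bochnak, M. Coste, M.-F. Roy,
*Real Algebraic Geometry* (1998), §2.2.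
-/

noncomputable section

open MeasureTheory Set
open Literature.NumberTheory.Transcendental
open Literature.ModelTheory.ExponentialFields (IsSemialgebraic isSemialgebraic_setOf_eval_pos isSemialgebraic_setOf_eval_nonneg)
open MvPolynomial (aeval X C)

namespace Summit.KontsevichZagierPeriods.InverseLandau

namespace MinkowskiBinary

/-- The base `τ = {y₀ > 0, 2|y₂| ≤ y₀, y₀² < 1 + y₂²}` is `ℚ`-semialgebraic. [folklore] -/
theorem isSemialgebraic_base :
    IsSemialgebraic ℚ {x : Fin 2 → ℝ | 0 < x 0 ∧ 2 * |x 1| ≤ x 0 ∧ x 0 ^ 2 < 1 + x 1 ^ 2} := by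
  convert (((isSemialgebraic_setOf_eval_pos (k := ℚ) (R := ℝ) (X 0 : MvPolynomial (Fin 2) ℚ)).inter
    (isSemialgebraic_setOf_eval_nonneg (k := ℚ) (R := ℝ) (X 0 - 2 * X 1 : MvPolynomial (Fin 2) ℚ))).inter
    (isSemialgebraic_setOf_eval_nonneg (k := ℚ) (R := ℝ) (X 0 + 2 * X 1 : MvPolynomial (Fin 2) ℚ))).inter
    (isSemialgebraic_setOf_eval_pos (k := ℚ) (R := ℝ) (1 + X 1 ^ 2 - X 0 ^ 2 : MvPolynomial (Fin 2) ℚ)) using 1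
  ext x
  simp only [mem_setOf_eq, mem_inter_iff, map_pow, map_mul, map_sub, map_add, map_one, map_ofNat,
    MvPolynomial.aeval_X, sub_nonneg, sub_pos]
  rw [← le_div_iff₀' two_pos, abs_le]
  constructor
  · rintro ⟨h0, ⟨h1, h2⟩, h3⟩; exact ⟨⟨⟨h0, by linarith⟩, by linarith⟩, by linarith⟩
  · rintro ⟨⟨⟨h0, h1⟩, h2⟩, h3⟩; exact ⟨h0, ⟨by linarith, by linarith⟩, by linarith⟩

/-- The upper edge `b = (1 + y₂²)/y₀` is `ℚ`-semialgebraic on the base. [cite: BCR1998, §2.2] -/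
theorem isSemialgebraicFunOn_edge :
    IsSemialgebraicFunOn ℚ {x : Fin 2 → ℝ | 0 < x 0 ∧ 2 * |x 1| ≤ x 0 ∧ x 0 ^ 2 < 1 + x 1 ^ 2}
      (fun x => (1 + x 1 ^ 2) / x 0) :=
  (isSemialgebraicFunOn_aeval_div_aeval isSemialgebraic_base (1 + X 1 ^ 2 : MvPolynomial (Fin 2) ℚ) (X 0)
    (fun x hx => by simpa using hx.1.ne')).congr fun x _ => by simp

/-- **Steps 1–2.** Relabel `(y₀, y₁, y₂) ↦ (y₀, y₂, y₁)` (rule (2)), close the band by the null graph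
`{y₁ = (1 + y₂²)/y₀}` (rule (1); on `R`, `y₀ > 0` and the `y₁`-fibre is `[y₀, (1 + y₂²)/y₀)`), then ONE Newton–Leibniz
move along `y₁`, primitive `y₁` (`tateLifting_bandArea`): `[R, 1] ≡ [τ, (1 + y₂²)/y₀ − y₀]`. [cite: KontsevichZagier2001, §1.2] -/
theorem cone_to_base (r : KZ.IntegralRep 3)
    (hrd : r.domain = {y : Fin 3 → ℝ | 2 * |y 2| ≤ y 0 ∧ y 0 ≤ y 1 ∧ 0 < y 0 * y 1 - y 2 ^ 2 ∧
      y 0 * y 1 - y 2 ^ 2 < 1}) (hri : EqOn r.integrand (fun _ => 1) r.domain) :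
    ∃ r₂ : KZ.IntegralRep 2, r₂.domain = {x : Fin 2 → ℝ | 0 < x 0 ∧ 2 * |x 1| ≤ x 0 ∧ x 0 ^ 2 < 1 + x 1 ^ 2} ∧
      (r₂.integrand = fun x => (1 + x 1 ^ 2) / x 0 - x 0) ∧ KZ.of r - KZ.of r₂ ∈ KZ.relations := by
  set τ := {x : Fin 2 → ℝ | 0 < x 0 ∧ 2 * |x 1| ≤ x 0 ∧ x 0 ^ 2 < 1 + x 1 ^ 2}
  set r₁ := r.reindex (Equiv.swap 1 2) with hr₁
  have hmem : ∀ w, w ∈ r₁.domain ↔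
      (0 < w 0 ∧ 2 * |w 1| ≤ w 0 ∧ w 0 ^ 2 < 1 + w 1 ^ 2) ∧ w 0 ≤ w 2 ∧ w 2 < (1 + w 1 ^ 2) / w 0 := by
    intro w
    rw [hr₁, KZ.IntegralRep.reindex_domain, mem_setOf_eq, hrd, mem_setOf_eq]
    simp only [Equiv.swap_apply_right, Equiv.swap_apply_left,
      Equiv.swap_apply_of_ne_of_ne (show (0 : Fin 3) ≠ 1 by decide) (show (0 : Fin 3) ≠ 2 by decide)]
    constructor
    · rintro ⟨h1, h2, h3, h4⟩
      have h0 : 0 < w 0 := by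
        by_contra h
        nlinarith [abs_nonneg (w 1), mul_nonneg_of_nonpos_of_nonpos (not_lt.1 h) (not_lt.1 h), sq_nonneg (w 1)]
      exact ⟨⟨h0, h1, by nlinarith [mul_le_mul_of_nonneg_left h2 h0.le]⟩, h2, by rw [lt_div_iff₀ h0]; linarith⟩
    · rintro ⟨⟨h0, h1, -⟩, h2, h4⟩
      rw [lt_div_iff₀ h0] at h4
      have hsq : |w 1| ^ 2 = w 1 ^ 2 := sq_abs _
      exact ⟨h1, h2, by nlinarith [mul_le_mul_of_nonneg_left h2 h0.le, abs_nonneg (w 1)], by linarith⟩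
  have hsub : r₁.domain ⊆ KZlog.band τ (fun x => x 0) (fun x => (1 + x 1 ^ 2) / x 0) := fun w hw =>
    ⟨((hmem w).1 hw).1, ((hmem w).1 hw).2.1, ((hmem w).1 hw).2.2.le⟩
  have hdiff : KZlog.band τ (fun x => x 0) (fun x => (1 + x 1 ^ 2) / x 0) \ r₁.domain ⊆
      {z | Fin.init z ∈ τ ∧ z (Fin.last 2) = (fun x : Fin 2 → ℝ => (1 + x 1 ^ 2) / x 0) (Fin.init z)} := by
    rintro w ⟨⟨h1, h2, h3⟩, hw⟩
    rw [hmem] at hw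
    exact ⟨h1, le_antisymm h3 (not_lt.1 fun h => hw ⟨h1, h2, h⟩)⟩
  have hnull := measure_mono_null hdiff (KZ.volume_graph_eq_zero isSemialgebraicFunOn_edge)
  have h1 : EqOn r₁.integrand (fun _ => 1) r₁.domain := fun w hw => hri hw
  obtain ⟨Rb, hRbd, hRbi⟩ := KZ.exists_oneRep (KZlog.isSemialgebraic_band
    (isSemialgebraicFunOn_apply isSemialgebraic_base 0) isSemialgebraicFunOn_edge) ((measure_mono (fun w hw => by
      by_cases h : w ∈ r₁.domain
      · exact Or.inl h
      · exact Or.inr ⟨hw, h⟩)).trans_lt (measure_union_lt_top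
    (BandArea.volume_lt_top_of_eqOn_one r₁ h1) (hnull.trans_lt ENNReal.zero_lt_top))).ne
  rw [← hRbd] at hsub hnull
  obtain ⟨r₂, hr₂d, hr₂i, hrel⟩ := tateLifting_bandArea 2 Rb τ (fun x => x 0) (fun x => (1 + x 1 ^ 2) / x 0)
    isSemialgebraic_base (isSemialgebraicFunOn_apply isSemialgebraic_base 0) isSemialgebraicFunOn_edge
    (fun x hx => by rw [le_div_iff₀ hx.1]; nlinarith [hx.2.2]) hRbd (by rw [hRbi]; exact fun _ _ => rfl)
  refine ⟨r₂, hr₂d, hr₂i, ?_⟩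
  have hC : KZ.of (Rb.restrict r₁.domain r₁.isSemialgebraic_domain hsub) - KZ.of r₁ ∈ KZ.relations :=
    KZ.of_sub_of_mem_relations_of_eqOn rfl fun w hw => by
      show Rb.integrand w = r₁.integrand w
      rw [hRbi, h1 hw]
  convert add_mem (sub_mem (sub_mem (KZ.of_sub_of_reindex_mem_relations r (Equiv.swap 1 2)) hC)
    (KZ.IntegralRep.of_sub_of_restrict_mem_relations Rb r₁.isSemialgebraic_domain hsub hnull)) hrel using 1
  abel

/-- **Step 3.** ONE change of variables (rule (2), `tateLifting_pullback`) along the shear `(t, y₀) ↦ (y₀, y₀t)`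
of `Ω = {t² ≤ ¼, 0 < y₀, y₀²(1 − t²) < 1}` onto the base `τ` (Jacobian `(0, 1; y₀, t)`, `|det| = y₀`):
`[τ, (1 + y₂²)/y₀ − y₀] ≡ [Ω, g]` with `g = 1 − y₀²(1 − t²)` on `Ω`. [cite: KontsevichZagier2001, §1.2 rule (2)] -/
theorem base_to_shearSource (r₂ : KZ.IntegralRep 2)
    (hr₂d : r₂.domain = {x : Fin 2 → ℝ | 0 < x 0 ∧ 2 * |x 1| ≤ x 0 ∧ x 0 ^ 2 < 1 + x 1 ^ 2})
    (hr₂i : r₂.integrand = fun x => (1 + x 1 ^ 2) / x 0 - x 0) :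
    ∃ r₃ : KZ.IntegralRep 2, r₃.domain = {z : Fin 2 → ℝ | z 0 ^ 2 ≤ 1 / 4 ∧ 0 < z 1 ∧ z 1 ^ 2 * (1 - z 0 ^ 2) < 1} ∧
      EqOn r₃.integrand (fun z => 1 - z 1 ^ 2 * (1 - z 0 ^ 2)) r₃.domain ∧ KZ.of r₂ - KZ.of r₃ ∈ KZ.relations := by
  have hΩ : IsSemialgebraic ℚ {z : Fin 2 → ℝ | z 0 ^ 2 ≤ 1 / 4 ∧ 0 < z 1 ∧ z 1 ^ 2 * (1 - z 0 ^ 2) < 1} := by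
    convert ((isSemialgebraic_setOf_eval_pos (k := ℚ) (R := ℝ) (X 1 : MvPolynomial (Fin 2) ℚ)).inter
      (isSemialgebraic_setOf_eval_nonneg (k := ℚ) (R := ℝ) (1 - 4 * X 0 ^ 2 : MvPolynomial (Fin 2) ℚ))).inter
      (isSemialgebraic_setOf_eval_pos (k := ℚ) (R := ℝ) (1 - X 1 ^ 2 * (1 - X 0 ^ 2) : MvPolynomial (Fin 2) ℚ))
      using 1
    ext z
    simp only [mem_setOf_eq, mem_inter_iff, map_pow, map_mul, map_sub, map_one, map_ofNat, MvPolynomial.aeval_X,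
      sub_nonneg, sub_pos]
    exact ⟨fun ⟨h0, h1, h3⟩ => ⟨⟨h1, by linarith⟩, h3⟩, fun ⟨⟨h1, h0⟩, h3⟩ => ⟨by linarith, h1, h3⟩⟩
  have hder : ∀ z : Fin 2 → ℝ, HasFDerivAt (fun y : Fin 2 → ℝ => (![y 1, y 1 * y 0] : Fin 2 → ℝ))
      (LinearMap.toContinuousLinearMap (Matrix.toLin' !![(0 : ℝ), 1; z 1, z 0])) z := fun z => by
    have h0 : HasFDerivAt (fun y : Fin 2 → ℝ => y 0)
        (ContinuousLinearMap.proj (R := ℝ) (φ := fun _ : Fin 2 => ℝ) 0) z := hasFDerivAt_apply 0 z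
    have h1 : HasFDerivAt (fun y : Fin 2 → ℝ => y 1)
        (ContinuousLinearMap.proj (R := ℝ) (φ := fun _ : Fin 2 => ℝ) 1) z := hasFDerivAt_apply 1 z
    rw [hasFDerivAt_pi']
    refine Fin.forall_fin_two.mpr ⟨?_, ?_⟩
    · exact h1.congr_fderiv (ContinuousLinearMap.ext fun v => by
        simp [Matrix.toLin'_apply, dotProduct, Fin.sum_univ_two])
    · exact (h1.mul h0).congr_fderiv (ContinuousLinearMap.ext fun v => by
        simp [Matrix.toLin'_apply, dotProduct, Fin.sum_univ_two])
  obtain ⟨r₃, hd, hi, hrel⟩ := tateLifting_pullback 2 r₂ _ (fun y : Fin 2 → ℝ => (![y 1, y 1 * y 0] : Fin 2 → ℝ))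
    (fun z => LinearMap.toContinuousLinearMap (Matrix.toLin' !![(0 : ℝ), 1; z 1, z 0])) (fun z => z 1) hΩ
    (IsSemialgebraicMapOn.of_forall hΩ (Fin.forall_fin_two.mpr
      ⟨by simpa using isSemialgebraicFunOn_aeval hΩ (X 1 : MvPolynomial (Fin 2) ℚ),
       (isSemialgebraicFunOn_aeval hΩ (X 1 * X 0 : MvPolynomial (Fin 2) ℚ)).congr fun z _ => by simp⟩))
    (fun z _ => (hder z).hasFDerivWithinAt)
    (fun x hx y hy hxy => by
      have h1 : x 1 = y 1 := by simpa using congrFun hxy 0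
      have h := congrFun hxy 1
      simp only [Matrix.cons_val_one, Matrix.cons_val_fin_one, h1] at h
      exact funext (Fin.forall_fin_two.mpr ⟨mul_left_cancel₀ hy.2.1.ne' h, h1⟩))
    (by
      rw [hr₂d]
      refine Set.ext fun x => ⟨?_, fun ⟨h0, h1, h2⟩ => ?_⟩
      · rintro ⟨z, ⟨h0, h1, h2⟩, rfl⟩
        have habs : |z 0| ≤ 1 / 2 := (SLTwoZ.abs_le_half_iff _).2 h0
        refine ⟨h1, ?_, by show z 1 ^ 2 < 1 + (z 1 * z 0) ^ 2; nlinarith⟩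
        show 2 * |z 1 * z 0| ≤ z 1
        rw [abs_mul, abs_of_pos h1]
        nlinarith
      · have habs : |x 1 / x 0| ≤ 1 / 2 := by
          rw [abs_div, abs_of_pos h0, div_le_iff₀ h0]
          linarith
        refine ⟨![x 1 / x 0, x 0], ⟨(SLTwoZ.abs_le_half_iff _).1 habs, h0, ?_⟩, ?_⟩
        · show x 0 ^ 2 * (1 - (x 1 / x 0) ^ 2) < 1
          rw [div_pow, mul_sub, mul_one, mul_div_cancel₀ _ (pow_ne_zero 2 h0.ne')]
          linarith
        · exact funext (Fin.forall_fin_two.mpr ⟨rfl, by show x 0 * (x 1 / x 0) = x 1; field_simp⟩))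
    (isSemialgebraicFunOn_apply hΩ 1)
    (fun z hz => by
      rw [LinearMap.det_toContinuousLinearMap, LinearMap.det_toLin', Matrix.det_fin_two_of]
      simp [abs_of_pos hz.2.1])
  refine ⟨r₃, hd, fun z hz => ?_, hrel⟩
  have hz1 : z 1 ≠ 0 := by rw [hd] at hz; exact hz.2.1.ne'
  rw [hi, hr₂i]
  simp only [Matrix.cons_val_zero, Matrix.cons_val_one, Matrix.cons_val_fin_one]
  field_simp
  ring

/-- The edge `b(t) = √(1 − t²)/(1 − t²) = 1/√(1 − t²)` is `ℚ`-semialgebraic on `{t² ≤ ¼}` (an arc of the conic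
`s² = 1 − t²`), and there `3s ≠ 0` at `s = √(1 − t²)`. [cite: KontsevichZagier2001, §1.1] -/
theorem arcEdge :
    IsSemialgebraicFunOn ℚ {x : Fin 1 → ℝ | x 0 ^ 2 ≤ 1 / 4} (fun x => √(1 - x 0 ^ 2) / (1 - x 0 ^ 2)) ∧
    ∀ x : Fin 1 → ℝ, x 0 ^ 2 ≤ 1 / 4 → (aeval ![x 0, √(((-1 : algebraicClosure ℚ ℝ) : ℝ) * x 0 ^ 2 +
      ((0 : algebraicClosure ℚ ℝ) : ℝ) * x 0 + ((1 : algebraicClosure ℚ ℝ) : ℝ))]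
        (3 * X 1 : MvPolynomial (Fin 2) (algebraicClosure ℚ ℝ)) : ℝ) ≠ 0 := by
  refine ⟨GenusZero.isSemialgebraicFunOn_arc SLTwoZ.isSemialgebraic_arcsinBase (-1) 0 1 (X 1) (1 - X 0 ^ 2)
    (fun x hx => ?_) (fun x _ => by rw [SLTwoZ.conic_eq]; simp), fun x hx => ?_⟩
  · have hx' : x 0 ^ 2 ≤ 1 / 4 := hx
    simp only [map_sub, map_one, map_pow, MvPolynomial.aeval_X, Matrix.cons_val_zero]
    exact (by linarith : (0 : ℝ) < 1 - x 0 ^ 2).ne'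
  · rw [SLTwoZ.conic_eq]
    simp only [map_mul, map_ofNat, MvPolynomial.aeval_X, Matrix.cons_val_one, Matrix.cons_val_fin_one]
    exact mul_ne_zero three_ne_zero (Real.sqrt_pos.2 (by linarith)).ne'

/-- **The arcsine one-form** `A = [{t² ≤ ¼}, 2/(3√(1 − t²))]` exists and represents
`(2/3)(arcsin ½ − arcsin (−½)) = (2/3)(π/3) = π · (2/9)`. [folklore] -/
theorem exists_arcRep : ∃ A : KZ.IntegralRep 1, A.domain = {x : Fin 1 → ℝ | x 0 ^ 2 ≤ 1 / 4} ∧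
    (A.integrand = fun x => 2 / (3 * √(1 - x 0 ^ 2))) ∧ A.value = Real.pi * (2 / 9) := by
  have hset : {x : Fin 1 → ℝ | x 0 ^ 2 ≤ 1 / 4} = {x | x 0 ∈ Icc (-(1 / 2) : ℝ) (1 / 2)} :=
    Set.ext fun x => ArcsinBand.sq_le_quarter_iff (x 0)
  have hK : IsCompact {x : Fin 1 → ℝ | x 0 ^ 2 ≤ 1 / 4} :=
    hset ▸ (Homeomorph.funUnique (Fin 1) ℝ).isCompact_preimage.2 isCompact_Icc
  refine ⟨⟨{x : Fin 1 → ℝ | x 0 ^ 2 ≤ 1 / 4}, fun x => 2 / (3 * √(1 - x 0 ^ 2)), SLTwoZ.isSemialgebraic_arcsinBase,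
    GenusZero.isSemialgebraicFunOn_arc SLTwoZ.isSemialgebraic_arcsinBase (-1) 0 1 2 (3 * X 1) arcEdge.2
      (fun x _ => by rw [SLTwoZ.conic_eq]; simp),
    ContinuousOn.integrableOn_compact hK (ContinuousOn.div continuousOn_const (by fun_prop) fun x hx =>
      mul_ne_zero three_ne_zero (Real.sqrt_pos.2 (by have : x 0 ^ 2 ≤ 1 / 4 := hx; linarith)).ne')⟩,
    rfl, rfl, ?_⟩
  have htr : ∫ x in {x : Fin 1 → ℝ | x 0 ∈ Icc (-(1 / 2) : ℝ) (1 / 2)}, 2 / (3 * √(1 - x 0 ^ 2)) =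
      ∫ t in Icc (-(1 / 2) : ℝ) (1 / 2), 2 / (3 * √(1 - t ^ 2)) :=
    (volume_preserving_funUnique (Fin 1) ℝ).setIntegral_preimage_emb
      (MeasurableEquiv.funUnique (Fin 1) ℝ).measurableEmbedding (fun t : ℝ => 2 / (3 * √(1 - t ^ 2))) _
  show ∫ x in {x : Fin 1 → ℝ | x 0 ^ 2 ≤ 1 / 4}, 2 / (3 * √(1 - x 0 ^ 2)) = Real.pi * (2 / 9)
  rw [hset, htr, setIntegral_congr_fun measurableSet_Icc (g := fun t : ℝ => 2 / 3 * (1 / √(1 - t ^ 2)))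
    (fun t _ => by ring), integral_const_mul, ArcsinBand.integral_invSqrt]
  ring

/-- **Step 4.** `Ω` is co-null in the closed arcsine band `Ḡ` (face `{y₀ = 0}` and level set `y₀²(1 − t²) = 1`,
rule (1)); on `[Ḡ, 1 − y₀²(1 − t²)]` ONE Newton–Leibniz move along `y₀` (rule (3)), primitive `G = y₀ − y₀³(1 − t²)/3`,
edges `0 ≤ y₀ ≤ b(t) = 1/√(1 − t²)`: `G(t, b) − G(t, 0) = 2b/3 = 2/(3√(1 − t²))`. [cite: KontsevichZagier2001, §1.2 rule (3)] -/
theorem shearSource_to_arc (r₃ : KZ.IntegralRep 2)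
    (hr₃d : r₃.domain = {z : Fin 2 → ℝ | z 0 ^ 2 ≤ 1 / 4 ∧ 0 < z 1 ∧ z 1 ^ 2 * (1 - z 0 ^ 2) < 1})
    (hr₃i : EqOn r₃.integrand (fun z => 1 - z 1 ^ 2 * (1 - z 0 ^ 2)) r₃.domain) (A : KZ.IntegralRep 1)
    (hAd : A.domain = {x : Fin 1 → ℝ | x 0 ^ 2 ≤ 1 / 4}) (hAi : A.integrand = fun x => 2 / (3 * √(1 - x 0 ^ 2))) :
    KZ.of r₃ - KZ.of A ∈ KZ.relations := by
  -- the polynomial representation `[Ḡ, 1 − y₀²(1 − t²)]` over the closed (bounded) arcsine band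
  obtain ⟨g, hgd, hgi⟩ : ∃ g : KZ.IntegralRep 2, g.domain = {z | z 0 ^ 2 ≤ 1 / 4 ∧ 0 ≤ z 1 ∧
      z 1 ^ 2 * (1 - z 0 ^ 2) ≤ 1} ∧ g.integrand = fun z => 1 - z 1 ^ 2 * (1 - z 0 ^ 2) :=
    ⟨⟨_, _, SLTwoZ.isSemialgebraic_arcsinBand, (isSemialgebraicFunOn_aeval SLTwoZ.isSemialgebraic_arcsinBand
      (1 - X 1 ^ 2 * (1 - X 0 ^ 2) : MvPolynomial (Fin 2) ℚ)).congr fun z _ => by simp,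
      ((by fun_prop : Continuous fun z : Fin 2 → ℝ => 1 - z 1 ^ 2 * (1 - z 0 ^ 2)).continuousOn.integrableOn_compact
        (isCompact_closedBall 0 2)).mono_set SLTwoZ.arcsinBand_subset_closedBall⟩, rfl, rfl⟩
  have hsub : r₃.domain ⊆ g.domain := by
    rw [hr₃d, hgd]
    exact fun z ⟨h0, h1, h2⟩ => ⟨h0, h1.le, h2.le⟩
  have hnull : volume (g.domain \ r₃.domain) = 0 := by
    refine measure_mono_null (fun z hz => ?_) (measure_union_null (KZ.volume_setOf_last_eq_zero (n := 1) 0)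
      (volume_setOf_aeval_eq_zero (k := ℝ) (X 1 ^ 2 * (1 - X 0 ^ 2) - 1 : MvPolynomial (Fin 2) ℝ) fun h => by
        rw [Algebra.algebraMap_self, MvPolynomial.map_id] at h
        simpa using congrArg (MvPolynomial.eval 0) h))
    rw [hgd, hr₃d] at hz
    obtain ⟨⟨h0, h1, h2⟩, hz⟩ := hz
    rcases h1.eq_or_lt with h | h
    · exact Or.inl h.symm
    · refine Or.inr (show aeval z _ = 0 from ?_)
      simp [le_antisymm h2 (not_lt.1 fun h' => hz ⟨h0, h, h'⟩)]
  -- the primitive and the integrand on the fibres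
  have hFs : ∀ (x : Fin 1 → ℝ) (t : ℝ), (fun z : Fin 2 → ℝ => z 1 - z 1 ^ 3 * (1 - z 0 ^ 2) / 3) (Fin.snoc x t) =
      t - t ^ 3 * (1 - x 0 ^ 2) / 3 := fun x t => by simp [Fin.snoc]
  have hgs : ∀ (x : Fin 1 → ℝ) (t : ℝ), g.integrand (Fin.snoc x t) = 1 - t ^ 2 * (1 - x 0 ^ 2) := fun x t => by
    rw [hgi]; simp [Fin.snoc]
  have hN : KZ.of g - KZ.of A ∈ KZ.relations := by
    refine KZ.newtonLeibnizRel_subset_relations ⟨1, g, A, fun _ => 0, fun x => √(1 - x 0 ^ 2) / (1 - x 0 ^ 2),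
      fun z => z 1 - z 1 ^ 3 * (1 - z 0 ^ 2) / 3, ?_, ?_, hAd ▸ arcEdge.1, fun x hx => ?_, ?_,
      fun x _ => ?_, fun x _ t _ => ?_, fun x hx => ?_, rfl⟩
    · rw [hgd]
      exact (isSemialgebraicFunOn_aeval_div_aeval SLTwoZ.isSemialgebraic_arcsinBand
        (3 * X 1 - X 1 ^ 3 * (1 - X 0 ^ 2) : MvPolynomial (Fin 2) ℚ) 3 (fun _ _ => by simp)).congr
        fun z _ => by simp; ring
    · rw [hAd]; simpa using isSemialgebraicFunOn_ratCast SLTwoZ.isSemialgebraic_arcsinBase 0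
    · exact div_nonneg (Real.sqrt_nonneg _) (by rw [hAd] at hx; have hx' : x 0 ^ 2 ≤ 1 / 4 := hx; linarith)
    · rw [hAd, hgd]; exact SLTwoZ.arcsinBand_eq
    · simp only [hFs]; fun_prop
    · simp only [hFs, hgs]
      refine ((hasDerivAt_id t).sub (((hasDerivAt_pow 3 t).mul_const (1 - x 0 ^ 2)).div_const 3)).congr_deriv ?_
      norm_num; ring
    · rw [hAd] at hx
      have hq : 0 < 1 - x 0 ^ 2 := by have : x 0 ^ 2 ≤ 1 / 4 := hx; linarith
      have h1 : √(1 - x 0 ^ 2) * √(1 - x 0 ^ 2) = 1 - x 0 ^ 2 := Real.mul_self_sqrt hq.le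
      have h2 : √(1 - x 0 ^ 2) ≠ 0 := (Real.sqrt_pos.2 hq).ne'
      rw [hAi, hFs, hFs]
      field_simp
      nlinarith [h1]
  have hB : KZ.of (g.restrict r₃.domain r₃.isSemialgebraic_domain hsub) - KZ.of r₃ ∈ KZ.relations :=
    KZ.of_sub_of_mem_relations_of_eqOn rfl fun z hz => by
      show g.integrand z = r₃.integrand z
      rw [hgi, hr₃i hz]
  convert sub_mem (sub_mem hN (KZ.IntegralRep.of_sub_of_restrict_mem_relations g r₃.isSemialgebraic_domain hsub
    hnull)) hB using 1
  abel

/-- The circle `9(t² + s²) = 2` as the conic `s² = −9t² + 0·t + 2` over `ℚ̄ ∩ ℝ`. [folklore] -/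
theorem conic_eq9 (x : Fin 1 → ℝ) :
    ((-9 : algebraicClosure ℚ ℝ) : ℝ) * x 0 ^ 2 + ((0 : algebraicClosure ℚ ℝ) : ℝ) * x 0 +
      ((2 : algebraicClosure ℚ ℝ) : ℝ) = 2 - 9 * x 0 ^ 2 := by
  have h9 : ((9 : algebraicClosure ℚ ℝ) : ℝ) = 9 := rfl
  have h2 : ((2 : algebraicClosure ℚ ℝ) : ℝ) = 2 := rfl
  push_cast [h9, h2]
  ring

/-- The base `{9t² < 2}` of the disc band is `ℚ`-semialgebraic, the upper arc `√(2 − 9t²)/3` of the circle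
is `ℚ`-semialgebraic on it, and its square is `(2 − 9t²)/9`. [cite: KontsevichZagier2001, §1.1] -/
theorem discArc : IsSemialgebraic ℚ {x : Fin 1 → ℝ | 9 * x 0 ^ 2 < 2} ∧
    IsSemialgebraicFunOn ℚ {x : Fin 1 → ℝ | 9 * x 0 ^ 2 < 2} (fun x => √(2 - 9 * x 0 ^ 2) / 3) ∧
      ∀ t : ℝ, 9 * t ^ 2 < 2 → (√(2 - 9 * t ^ 2) / 3) ^ 2 = (2 - 9 * t ^ 2) / 9 := by
  have hτ : IsSemialgebraic ℚ {x : Fin 1 → ℝ | 9 * x 0 ^ 2 < 2} := by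
    convert isSemialgebraic_setOf_eval_pos (k := ℚ) (R := ℝ) (2 - 9 * X 0 ^ 2 : MvPolynomial (Fin 1) ℚ) using 1
    ext x
    simp [sub_pos]
  exact ⟨hτ, GenusZero.isSemialgebraicFunOn_arc hτ (-9) 0 2 (X 1) 3 (fun x _ => by simp)
    (fun x _ => by rw [conic_eq9]; simp), fun t ht => by rw [div_pow, Real.sq_sqrt (by linarith)]; norm_num⟩

/-- **The disc band** `[B, 1]`, `B = {9t² < 2, −√(2 − 9t²)/3 ≤ s ≤ √(2 − 9t²)/3}` (the open disc of radius
`√(2/9)` and two null arcs; it lies in the unit disc), exists. [folklore] -/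
theorem exists_discBandRep : ∃ d : KZ.IntegralRep 2,
    d.domain = KZlog.band {x : Fin 1 → ℝ | 9 * x 0 ^ 2 < 2} (fun x => -(√(2 - 9 * x 0 ^ 2) / 3))
      (fun x => √(2 - 9 * x 0 ^ 2) / 3) ∧ d.integrand = fun _ => 1 := by
  obtain ⟨-, hsa, hsq⟩ := discArc
  refine KZ.exists_oneRep (KZlog.isSemialgebraic_band (hsa.neg.congr fun _ _ => rfl) hsa) (ne_top_of_le_ne_top
    (ComplexOrientations.TypeOneIdentities.volume_openDisc_ne_top 1) (measure_mono fun z ⟨h0, h1, h2⟩ => ?_))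
  have h : z 1 ^ 2 ≤ (√(2 - 9 * z 0 ^ 2) / 3) ^ 2 := sq_le_sq' h1 h2
  have h0' : 9 * z 0 ^ 2 < 2 := h0
  rw [hsq _ h0'] at h
  show z 0 ^ 2 + z 1 ^ 2 < 1
  nlinarith

end MinkowskiBinary

open MinkowskiBinary in
/-- **MINKOWSKI-REDUCED BINARY FORMS INSIDE THE RULES** (stub `stub_minkowskiBinaryAccessible` of line `Sketch`
for crux `TateLifting`; item `MinkowskiBinaryAccessible`, stmt-KontsevichZagierPeriods-4419, route SiegelTamagawa,
verbatim): the volume of the cone of Minkowski-reduced positive binary forms of discriminant `< 1` is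
KZ-equivalent to the open disc of radius `√(2/9)` (both `2π/9`): Newton–Leibniz along `y₁`, the shear
`y₂ = y₀ t`, Newton–Leibniz along `y₀` with the edge `1/√(1 − t²)`, and the conic-band kernel against the disc
as a band of the conic `9(t² + s²) = 2`. [cite: KontsevichZagier2001, §1.2] -/
theorem tateLifting_minkowskiBinaryAccessible :
    ∀ (r : KZ.IntegralRep 3) (r' : KZ.IntegralRep 2), r.domain = {y : Fin 3 → ℝ | 2 * |y 2| ≤ y 0 ∧ y 0 ≤ y 1 ∧ 0 < y 0 * y 1 - y 2 ^ 2 ∧ y 0 * y 1 - y 2 ^ 2 < 1} → Set.EqOn r.integrand (fun _ => 1) r.domain → r'.domain = {x : Fin 2 → ℝ | x 0 ^ 2 + x 1 ^ 2 < 2 / 9} → Set.EqOn r'.integrand (fun _ => 1) r'.domain → KZ.Equivalent r r' := by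
  intro r r' hrd hri hr'd hr'i
  obtain ⟨r₂, hr₂d, hr₂i, h₁⟩ := cone_to_base r hrd hri
  obtain ⟨r₃, hr₃d, hr₃i, h₂⟩ := base_to_shearSource r₂ hr₂d hr₂i
  obtain ⟨A, hAd, hAi, hAv⟩ := exists_arcRep
  have h₃ := shearSource_to_arc r₃ hr₃d hr₃i A hAd hAi
  obtain ⟨d, hdd, hdi⟩ := exists_discBandRep
  obtain ⟨hτ, -, hsq⟩ := discArc
  -- the open disc is co-null in the disc band (two arcs of the circle `9(t² + s²) = 2`)
  have hsub : r'.domain ⊆ d.domain := fun z hz => by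
    rw [hr'd] at hz
    have hz' : z 0 ^ 2 + z 1 ^ 2 < 2 / 9 := hz
    have h0 : 9 * z 0 ^ 2 < 2 := by nlinarith [sq_nonneg (z 1)]
    rw [hdd]
    exact ⟨h0, abs_le_of_sq_le_sq' (by show z 1 ^ 2 ≤ (√(2 - 9 * z 0 ^ 2) / 3) ^ 2; rw [hsq _ h0]; linarith)
      (div_nonneg (Real.sqrt_nonneg _) (by norm_num))⟩
  have hnull : volume (d.domain \ r'.domain) = 0 := by
    refine measure_mono_null (fun z hz => ?_)
      (volume_setOf_aeval_eq_zero (k := ℝ) (9 * X 0 ^ 2 + 9 * X 1 ^ 2 - 2 : MvPolynomial (Fin 2) ℝ) fun h => by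
        rw [Algebra.algebraMap_self, MvPolynomial.map_id] at h
        have h' := congrArg (MvPolynomial.eval 1) h
        norm_num at h')
    rw [hdd, hr'd] at hz
    obtain ⟨⟨h0, h1, h2⟩, hz⟩ := hz
    have h0' : 9 * z 0 ^ 2 < 2 := h0
    have hz' : ¬ z 0 ^ 2 + z 1 ^ 2 < 2 / 9 := hz
    have h : z 1 ^ 2 ≤ (√(2 - 9 * z 0 ^ 2) / 3) ^ 2 := sq_le_sq' h1 h2
    rw [hsq _ h0'] at h
    show aeval z _ = 0
    simp only [map_sub, map_add, map_mul, map_pow, map_ofNat, MvPolynomial.aeval_X]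
    linarith [not_lt.1 hz']
  have h₅ : KZ.of d - KZ.of r' ∈ KZ.relations := by
    have hB : KZ.of (d.restrict r'.domain r'.isSemialgebraic_domain hsub) - KZ.of r' ∈ KZ.relations :=
      KZ.of_sub_of_mem_relations_of_eqOn rfl fun z hz => by
        show d.integrand z = r'.integrand z
        rw [hdi, hr'i hz]
    have h := add_mem (KZ.IntegralRep.of_sub_of_restrict_mem_relations d r'.isSemialgebraic_domain hsub hnull) hB
    rwa [sub_add_sub_cancel] at h
  -- the conic-band kernel: `[disc band, 1] ∼ A` (both represent `π · 2/9`)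
  have h₄ : KZ.Equivalent d A := by
    refine kzPeriodConjecture_conicBand_genusZero ⟨-9, 0, 2, -X 1, 3, X 1, 3, {x : Fin 1 → ℝ | 9 * x 0 ^ 2 < 2},
      fun x => -(√(2 - 9 * x 0 ^ 2) / 3), fun x => √(2 - 9 * x 0 ^ 2) / 3, d, hτ,
      fun x hx => ?_, fun x _ => by simp, fun x _ => by simp, fun x _ => by rw [conic_eq9]; simp [neg_div],
      fun x _ => by rw [conic_eq9]; simp, fun x _ => neg_le_self (div_nonneg (Real.sqrt_nonneg _) zero_le_three),
      hdd, by rw [hdi]; exact fun _ _ => rfl, rfl⟩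
      (Or.inl (Or.inr ⟨-1, 0, 1, 2, 3 * X 1, A, fun x hx => SLTwoZ.conic_pos_of_mem_arcsinBase x (hAd ▸ hx),
        fun x hx => arcEdge.2 x (by rw [hAd] at hx; exact hx),
        fun x _ => by beta_reduce; rw [hAi, SLTwoZ.conic_eq]; simp, rfl⟩)) ?_
    · have hx' : 9 * x 0 ^ 2 < 2 := hx
      rw [conic_eq9]; linarith
    · rw [KZ.Equivalent.value_eq_holds h₅, hAv]
      exact ComplexOrientations.TypeOneIdentities.stub_discRepValue (2 / 9) r' (by norm_num) hr'd fun v hv => hr'i hv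
  show KZ.of r - KZ.of r' ∈ KZ.relations
  convert add_mem (sub_mem (add_mem (add_mem h₁ h₂) h₃) h₄) h₅ using 1
  abel

end Summit.KontsevichZagierPeriods.InverseLandau
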